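import Summits.QuantumFields.YangMills.Theorems.UV3BranchExpansionHTopT3EveryL
import Summits.QuantumFields.YangMills.Theorems.UV3HTopConsumersLeTwenty
import HarnessLib

/-!
# R3 (cell `ym3-torus`, YM₃ on T³ — a ladder RUNG, NOT d = 4, NOT infinite volume, NOT a mass gap, NOT the Clay problem) —
# **(F-TOP-CONSUMERS-EVERY-L) THE THREE hTop CONSUMERS (start-closed family, flat a.e. mass envelope `hN08`, (S-ii), hJ(v3)) WITH hTop DISCHARGED FOR EVERY THREE-TORUS
# FAMILY — the range `F.L ≤ 20` of ✓`UV3HTopConsumersLeTwenty` GONE**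

Width seat `ym-ust-19936-w8` g13 on crux `stmt-QuantumFields-19936` `UnitScaleTilt.HistoryTailL` (`--supports`, helper; THEOREMS ONLY, 0 `def`, 0 `sorry`, default heartbeats);
★★OWNER WORD 101 (2026-08-30 07:53Z) (B).  Range-free siblings of this seat's (g12) ✓p763749 `UV3HTopConsumersLeTwenty` over ✓`UV3BranchExpansionHTopT3EveryL.topHaarPushforward_of_T3`
(hTop for EVERY `F : T3Family`, no hypothesis).  CREDIT: the four statements∕proofs are RE-DERIVED VERBATIM from dag-n08-d g50's kernel-clean scratch (545991ae1e7da632 §3 ∕ cert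
2871359d6fa2f2c7); they are my ✓p763749's four corollaries with `(h20 : F.L ≤ 20)` deleted and `topHaarPushforward_of_T3 F` in place of `…_of_T3_le_twenty F h20`.

CONTENTS.  ★★★ `startClosed_avT3_of_T3` (px8 g13's ✓`startClosed_avT3_of_topHaarPushforward`, NO hypothesis) · ★★★ `massRecP_avT3_le_exp_ae_of_T3` (dag-n08-d's flat a.e. envelope
`hN08`, NO hypothesis) · ★★★ `linMassEnvelope_all_of_T3` ((S-ii) from the (α) socket alone) · ★★ `hJ_of_T3` (hJ(v3) from the v3 socket alone).

HYP-SAT (★★OWNER RULING №42): §1's two theorems carry NO hypothesis beyond `F : T3Family`; §2–§3 keep the SOCKETS `h : AlphaInputsT3AC.Of F 𝔠` ∕ `OfV3At F 𝔠 a₀ a₁` displayed —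
registered CONTENT ((α) ∕ v3 package), not doors (RULING №38) — and the γ-window.  RECORD CURRENCY (WORDS 84 (2) ∕ 85 (4) ∕ 98 ∕ 17bs′ ∕ 101): SUPPLY for NODE O B3 ∕ Track A's
N08 — NOT rows of the 19936 registry v6 {EX, (O‴χₛ)}; 0 displayed hypotheses of PATH A∕B are discharged by this file; «the hTop shelf is FULL» after it (WORD 101).

HONEST SCOPE.  One-line corollaries BY NAME ([folklore] bookkeeping); nothing of the χ record ∕ (O‴χₛ) ∕ EX ∕ `HistoryTailL` (19936) ∕ `YM3TorusSU2` ∕ the rung ∕ d = 4 ∕ a mass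
gap ∕ Clay is proved.  YM₃ on T³ is rung R3 of the ladder; the Yang–Mills mass gap is NOT proved.

References: T. Bałaban, CMP **102** (1985) 255–275 [Balaban1985UV3] ((2) p. 256, (5) p. 257, (41) p. 266, (48) p. 268); T. Bałaban, CMP **109** (1987) 249–301 [Balaban1987RG1]
((0.4), (0.11) p. 253).
-/

set_option autoImplicit false

noncomputable section

namespace Summit.QuantumFields.YangMills.Theorems.UV3HTopConsumersT3

open MeasureTheory
open scoped ENNReal
open Literature.MathematicalPhysics.QuantumFieldTheory.Balaban1983to89
open Literature.MathematicalPhysics.QuantumFieldTheory.Balaban1983to89.T3ContinuumYM3Torus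
open Literature.MathematicalPhysics.QuantumFieldTheory.Balaban1983to89.T4AvgSensitivity (iterFrom)
open Literature.MathematicalPhysics.QuantumFieldTheory.Balaban1985CMP102
open Literature.MathematicalPhysics.QuantumFieldTheory.Balaban1985CMP102.Setting
open Summit.QuantumFields.Balaban3D.Carriers
open Summit.QuantumFields.Balaban3D.Proofs.Primitives
open Summit.QuantumFields.Balaban3D.Proofs.GroupModelLieC
open Summit.QuantumFields.Balaban3D.Proofs.StandardAC
open Summit.QuantumFields.Balaban3D.Proofs.InputsAC
open Summit.QuantumFields.Balaban3D.Proofs.MassesAC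
open Summit.QuantumFields.Balaban3D.Proofs.MassesPAC
open Summit.QuantumFields.Balaban3D.Proofs.TowerAC
open Summit.QuantumFields.YangMills.Theorems.UV3BranchExpansionHTopT3EveryL (topHaarPushforward_of_T3)
open Summit.QuantumFields.YangMills.Theorems.UV3StartClosedOfTopHaarPushforward (startClosed_avT3_of_topHaarPushforward
  massRecP_avT3_le_exp_ae_of_topHaarPushforward)

/-! ## §1 The N08 seat's two consumers, NO HYPOTHESIS -/

/-- ★★★ The canonical per-start family of `avT3` is (start)∕(step)-closed and capped at the top, for EVERY T³ family — hTop discharged by `topHaarPushforward_of_T3`.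
[cite: Balaban1985UV3, (2) p.256 + (5) p.257 (bookkeeping); Balaban1987RG1, (0.11) p.253] -/
theorem startClosed_avT3_of_T3 (F : T3Family) :
    ∃ A₁ : ℝ, 0 ≤ A₁ ∧ ∀ K : ℕ, ∃ μ : ℕ → ∀ k, Measure (GaugeField (F.P K) k (Matrix.specialUnitaryGroup (Fin 2) ℂ)),
      (∀ j, j < K → (fieldMeasure (F.P K) j _).map (avT3 F K j).avg ≤ μ j (j + 1)) ∧
      (∀ j k, j < k → k < K → (μ j k).map (avT3 F K k).avg ≤ μ j (k + 1)) ∧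
      (∀ j, j < K → μ j K ≤ ENNReal.ofReal (Real.exp A₁) • fieldMeasure (F.P K) K _) :=
  startClosed_avT3_of_topHaarPushforward F (topHaarPushforward_of_T3 F)

/-- ★★★ The flat a.e. envelope of the pinned masses of `avT3` (dag-n08-d's `hN08` letter), for EVERY T³ family, NO hypothesis.
[cite: Balaban1985UV3, (41) p.266 + (48) p.268 + (2) p.256 (bookkeeping); Balaban1987RG1, (0.11) p.253] -/
theorem massRecP_avT3_le_exp_ae_of_T3 (F : T3Family) :
    ∃ A₁ : ℝ, 0 ≤ A₁ ∧ ∀ (K : ℕ) (M₁ : ℕ) (Rcol : ℕ → ℕ) (εL εS : ℕ → ℝ) (r : Hist (F.P K) K),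
      ∀ᵐ W ∂(fieldMeasure (F.P K) K (Matrix.specialUnitaryGroup (Fin 2) ℂ)), massRecP M₁ Rcol εL εS (avT3 F K) K r W ≤ Real.exp A₁ :=
  massRecP_avT3_le_exp_ae_of_topHaarPushforward F (topHaarPushforward_of_T3 F)

/-! ## §2–§3 (S-ii) and hJ(v3) from the sockets alone, range-free -/

variable {F : T3Family} {𝔠 : AlphaConsts F.L (suGroupModel 2).N}

/-- ★★★ Row (S-ii) from the (α) socket alone, for EVERY T³ family. [cite: Balaban1985UV3, (41) p.266 + (2) p.256 + (5) p.257; Balaban1987RG1, (0.11) p.253] -/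
theorem linMassEnvelope_all_of_T3 (h : AlphaInputsT3AC.Of F 𝔠) (γ : ℝ) (hγ : 0 < γ) (hγ1 : γ ≤ (min 𝔠.gamma0 1) ^ 2) :
    ∃ A₁ : ℝ, 0 ≤ A₁ ∧ ∀ (K : ℕ) (r : Hist (F.P K) K),
      ∀ᵐ W ∂(fieldMeasure (F.P K) K (Matrix.specialUnitaryGroup (Fin 2) ℂ)),
        (inputOfAC 𝔠.lane (h.pkgAt γ hγ hγ1 K).X (h.pkgAt γ hγ hγ1 K).𝔖).W.mass K r W ≤ ((K : ℝ) + 1) * Real.exp A₁ :=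
  h.linMassEnvelope_all_of_topHaarPushforward γ hγ hγ1 (topHaarPushforward_of_T3 F)

/-- ★★ **hJ(v3) AT ITS EXACT DISPLAY LETTER FROM THE v3 SOCKET ALONE, FOR EVERY T³ FAMILY** (the R529-ym PURPOSE letter, `h20` gone).
[cite: Balaban1985UV3, (41) p.266 + (5) p.256 (the masses; bookkeeping)] -/
theorem hJ_of_T3 {a₀ a₁ : ℝ} (h : AlphaInputsT3AC.OfV3At F 𝔠 a₀ a₁) (hc : 0 < a₀ ∧ 0 < a₁ ∧ 𝔠.B₃ * a₁ ≤ a₀)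
    (γ : ℝ) (hγ : 0 < γ) (hγ1 : γ ≤ (min 𝔠.gamma0 1) ^ 2) :
    ∃ A₁ : ℝ, ∀ (K : ℕ) (r : Hist (F.P K) K),
      Hist.Admissible 𝔠.lane.carrier.M₁ (rcolOf (T3Scales F γ hγ (hγ1.trans (sq_min_one_le _ 𝔠.gamma0_pos)) K) 𝔠.lane.carrier) K r →
      r ≠ Hist.triv (F.P K) K →
      ∀ᵐ W ∂(fieldMeasure (F.P K) K (Matrix.specialUnitaryGroup (Fin 2) ℂ)),
        PinnedStep.massP 𝔠.lane (h.pkgAtV3 hc γ hγ hγ1 K).X K r W ≤ Real.exp A₁ :=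
  AlphaInputsT3AC.OfV3At.hJ_of_topHaarPushforward F 𝔠 γ hγ hγ1 h hc (topHaarPushforward_of_T3 F)

end Summit.QuantumFields.YangMills.Theorems.UV3HTopConsumersT3

end
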